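import Summits.CriticalPhenomena.PercolationContinuityZ3.Theorems.PercNearOneGluingNoHeavyLowerTailC3Transport

/-!
# `NoHeavyLowerTail` (crux stmt-CriticalPhenomena-4575), Sahi programme P4 (monotone coupling): the MINIMAL-INSERTION form of
# the `C₃` transport — "the covariance mass can be inserted at minimal elements" (structural conjecture R7, census-validated)

Support file (cell `prim-l12`, seat P4; `--supports stmt-CriticalPhenomena-4575`).  Companion of `…C3Transport` (transport form of Sahi's
`C₃`: `HasC3Flow`, `latticeE3_nonneg_of_hasC3Flow`).  No named facts, no sorries; one `@[conjecture]` statement.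

The `C₃` network for a pair of up-sets `(A,B)` (masses `a, b, m = m(A∩B)`, total `Z`) has two kinds of supply: the HARRIS mass
`Z·a·μ(y)` at `y ∈ B∖A` and `Z·b·μ(y)` at `y ∈ A∖B`, and the COVARIANCE mass `(Z·m − a·b)·μ(y)` at every `y ∉ A∩B`; capacity
`(Z(Z−a) + Z(Z−b) − (Zm − ab))·μ(x)` on `A∩B`.  A MINIMAL-COVARIANCE flow (`IsMinimalCovFlow`) is a pair of upward flows `(f_H, f_C)`
realising these supplies within the capacity such that the covariance flow `f_C` only moves `y` to MINIMAL elements of `(A∩B) ∩ [y)`.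
* `hasC3Flow_of_isMinimalCovFlow` — a minimal-covariance flow is a `C₃`-flow (hence `latticeE3 μ U A B ≥ 0` for all up-sets `U`).
* `C3MinimalCovFlowConjecture` (@[conjecture], "R7"): for every nonnegative LOG-MODULAR weight on a finite distributive lattice (on a Boolean
  lattice: every product measure) and every pair of up-sets such a flow exists; `latticeE3_nonneg_of_minimalCovFlowConjecture` — it implies
  Sahi's `C₃` / Kahn's Conjecture 5 for these weights.  STRICTLY STRONGER than `C₃` as a Hall system (extra cut inequalities on antichain
  pieces of `A∩B`).
CENSUS (exact rational max-flow): feasible for EVERY unordered pair of nontrivial up-sets of `{0,1}^k`: `k ≤ 4` under 13 product weights incl.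
skewed heterogeneous ones (13 861 pairs at `k = 4`, this seat), `k = 5` EXHAUSTIVE — all 28 724 410 pairs via 279 860 `S₅`-orbits at `p ≡ ½, 1/5, 4/5`
plus two random weight vectors on orbit representatives, 2 810 130 max-flows, 0 infeasible (ttrl2, `run/shared/lean/ttrl/c3flow/README.md`), `k = 5, 6`
random samples (13 000 / 30 000 pairs) clean.  The sharper variants are FALSE: restricting also the Harris mass to minterm insertions
`y ↦ y ∨ (∨S)` or to "useful" coordinates fails at `k = 4` for `(X₁, X₁X₂∨X₂X₃∨X₁X₄∨X₃X₄)` at `p = (1/4,19/20,3/20,9/20)`; requiring the Harris parts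
to extend to EXACT Harris transports fails at `k = 3` for `(X₁∨X₃, X₂∨X₃)`, `p = ½` (hand proof in the seat notes).  [this work]
-/

namespace Summit.CriticalPhenomena.PercolationContinuityZ3.Theorems.C3Transport

open Finset Literature.Probability.LatticeModels

variable {α : Type*} [Fintype α] [DecidableEq α]

/-- `x` is a minimal element of `(A ∩ B) ∩ [y)`: `y ≤ x ∈ A ∩ B` and no `z ∈ A ∩ B` lies in `[y, x)`. [this work] -/
def IsMinimalAbove [Preorder α] (A B : Finset α) (y x : α) : Prop :=
  y ≤ x ∧ x ∈ A ∩ B ∧ ∀ z, y ≤ z → z ∈ A ∩ B → z ≤ x → x ≤ z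

/-- Harris supply of the `C₃` network (homogeneous): `Z·m(A)·μ y` on `B ∖ A`, `Z·m(B)·μ y` on `A ∖ B`, else `0`. [this work] -/
def harrisSupply (μ : α → ℝ) (A B : Finset α) (y : α) : ℝ :=
  if y ∈ B ∧ y ∉ A then mass μ univ * mass μ A * μ y
  else if y ∈ A ∧ y ∉ B then mass μ univ * mass μ B * μ y else 0

/-- Covariance supply of the `C₃` network (homogeneous): `(Z·m(A∩B) − m(A)m(B))·μ y` off `A ∩ B`, `0` on it. [this work] -/
def covSupply (μ : α → ℝ) (A B : Finset α) (y : α) : ℝ :=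
  if y ∈ A ∩ B then 0 else (mass μ univ * mass μ (A ∩ B) - mass μ A * mass μ B) * μ y

/-- Capacity of the `C₃` network (homogeneous): `(Z(Z−m(A)) + Z(Z−m(B)) − (Z·m(A∩B) − m(A)m(B)))·μ x` on `A ∩ B`, else `0`. [this work] -/
def c3Capacity (μ : α → ℝ) (A B : Finset α) (x : α) : ℝ :=
  if x ∈ A ∩ B then
    (mass μ univ * (mass μ univ - mass μ A) + mass μ univ * (mass μ univ - mass μ B)
      - (mass μ univ * mass μ (A ∩ B) - mass μ A * mass μ B)) * μ x
  else 0

/-- The three network data recombine to the first-slot density: `capacity − harrisSupply − covSupply = μ·density`. [this work] -/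
theorem c3Capacity_sub_supply (μ : α → ℝ) (A B : Finset α) (z : α) :
    c3Capacity μ A B z - harrisSupply μ A B z - covSupply μ A B z = μ z * density μ A B z := by
  unfold c3Capacity harrisSupply covSupply density
  by_cases hA : z ∈ A <;> by_cases hB : z ∈ B <;> simp [hA, hB, Finset.mem_inter] <;> ring

/-- **A minimal-covariance `C₃`-flow** for the pair `(A,B)`: upward flows `f_H` (Harris mass, any target in `A∩B` above the source)
and `f_C` (covariance mass, only to MINIMAL elements of `A∩B` above the source) with the prescribed row sums, jointly within capacity.
[this work] -/
structure IsMinimalCovFlow [Preorder α] (μ : α → ℝ) (A B : Finset α) (fH fC : α → α → ℝ) : Prop where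
  /-- Harris flow nonnegative -/
  nonnegH : ∀ y x, 0 ≤ fH y x
  /-- covariance flow nonnegative -/
  nonnegC : ∀ y x, 0 ≤ fC y x
  /-- Harris flow is upward -/
  upH : ∀ y x, fH y x ≠ 0 → y ≤ x
  /-- covariance flow only reaches minimal elements of `A∩B` above the source -/
  minC : ∀ y x, fC y x ≠ 0 → IsMinimalAbove A B y x
  /-- row sums of the Harris flow -/
  rowH : ∀ y, ∑ x, fH y x = harrisSupply μ A B y
  /-- row sums of the covariance flow -/
  rowC : ∀ y, ∑ x, fC y x = covSupply μ A B y
  /-- joint capacity -/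
  col : ∀ x, ∑ y, (fH y x + fC y x) ≤ c3Capacity μ A B x

/-- **A minimal-covariance flow is a `C₃`-flow** (so `latticeE3 μ U A B ≥ 0` for every up-set `U`, by `latticeE3_nonneg_of_hasC3Flow`).
[this work] -/
theorem hasC3Flow_of_isMinimalCovFlow [Preorder α] {μ : α → ℝ} {A B : Finset α} {fH fC : α → α → ℝ}
    (h : IsMinimalCovFlow μ A B fH fC) : HasC3Flow μ A B := by
  refine ⟨fun y x => fH y x + fC y x, ⟨fun y x => add_nonneg (h.nonnegH y x) (h.nonnegC y x), fun y x hne => ?_⟩, fun z => ?_⟩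
  · by_cases hH : fH y x = 0
    · have hC : fC y x ≠ 0 := fun h0 => hne (by rw [hH, h0, add_zero])
      exact (h.minC y x hC).1
    · exact h.upH y x hH
  · have hrow : ∑ x, (fH z x + fC z x) = harrisSupply μ A B z + covSupply μ A B z := by
      rw [Finset.sum_add_distrib, h.rowH z, h.rowC z]
    unfold netInflow
    rw [hrow, ← c3Capacity_sub_supply]
    linarith [h.col z]

/-- `E₃ ≥ 0` in the first slot from a minimal-covariance flow. [this work] -/
theorem latticeE3_nonneg_of_isMinimalCovFlow [Preorder α] {μ : α → ℝ} {A B : Finset α} {fH fC : α → α → ℝ}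
    (h : IsMinimalCovFlow μ A B fH fC) {U : Finset α} (hU : IsUpperSet (U : Set α)) : 0 ≤ latticeE3 μ U A B :=
  latticeE3_nonneg_of_hasC3Flow (hasC3Flow_of_isMinimalCovFlow h) hU

/-- **CONJECTURE R7 ("the covariance mass can be inserted minimally").**  For every nonnegative LOG-MODULAR weight on a finite
distributive lattice (on the Boolean lattice `{0,1}^k`: every product measure) and every pair of up-sets there is a minimal-covariance
`C₃`-flow.  Strictly stronger than the transport form of Sahi's `C₃` / Kahn's Conjecture 5 for these weights (which it implies,
`latticeE3_nonneg_of_minimalCovFlowConjecture`); proposed as the flow-shaped induction hypothesis that the plain one-coordinate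
inductions lack.  Census: module docstring (`k ≤ 5` exhaustive, 0 infeasible).  An obligation / hypothesis, never a fact.
[this work] [status: open, census-validated k ≤ 5] -/
@[conjecture] def C3MinimalCovFlowConjecture : Prop :=
  ∀ (β : Type) [DistribLattice β] [Fintype β] [DecidableEq β] (μ : β → ℝ), 0 ≤ μ →
    (∀ a b, μ a * μ b = μ (a ⊓ b) * μ (a ⊔ b)) →
    ∀ A B : Finset β, IsUpperSet (A : Set β) → IsUpperSet (B : Set β) →
      ∃ fH fC : β → β → ℝ, IsMinimalCovFlow μ A B fH fC

/-- R7 implies Sahi's `C₃` on indicators for every nonnegative log-modular weight (in particular Kahn's Conjecture 5 in lattice form):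
`latticeE3 μ A B C ≥ 0` for all up-sets.  (`≤`-on-`Prop` spirit: an implication between open statements.) [this work] -/
theorem latticeE3_nonneg_of_minimalCovFlowConjecture (h : C3MinimalCovFlowConjecture) (β : Type) [DistribLattice β] [Fintype β]
    [DecidableEq β] {μ : β → ℝ} (hμ₀ : 0 ≤ μ) (hμ : ∀ a b, μ a * μ b = μ (a ⊓ b) * μ (a ⊔ b))
    {A B C : Finset β} (hA : IsUpperSet (A : Set β)) (hB : IsUpperSet (B : Set β)) (hC : IsUpperSet (C : Set β)) :
    0 ≤ latticeE3 μ A B C := by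
  obtain ⟨fH, fC, hf⟩ := h β μ hμ₀ hμ B C hB hC
  exact latticeE3_nonneg_of_isMinimalCovFlow hf hA

/-! ### CORRECTION (same session): `C3MinimalCovFlowConjecture` as stated — for ALL log-modular weights on finite distributive lattices —
is FALSE; the census behind it concerns BOOLEAN lattices (product measures on `{0,1}^k`).  Counterexample on the grid `Fin 3 × Fin 3`
(product of two 3-chains) with the product weight `q ⊗ q`, `q = (1/2, 1/4, 1/4)`, and `A = B =` the principal up-set of `(1,1)`:
`a = b = m = 1/4`, `Cov = 3/16`, `κ = 21/16`; the three sources `(0,0), (0,1), (1,0)` have `(1,1)` as their ONLY minimal `A∩B`-majorant, so a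
minimal-covariance flow must put `Cov·(μ(0,0)+μ(0,1)+μ(1,0)) = 3/32` into the single point `(1,1)` of capacity `κ·μ(1,1) = 21/256 < 24/256`.
(Seat census: the unrestricted `C₃`-flow exists on all these grid pairs; R7 fails on 31/513 pairs of `[3]×[3]`, 0 on `[2]×[2]×[3]`.)
Below: the refutation `not_C3MinimalCovFlowConjecture`, and the corrected conjecture `C3MinimalCovFlowConjectureCube` (product weights on the
Boolean lattice `Finset ι`), which is what the `k ≤ 5` census supports, with its consequence for `latticeE3`. -/

section Refutation

/-- The chain weight `q = (1/2, 1/4, 1/4)` on `Fin 3`. [this work] -/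
noncomputable def gridQ (i : Fin 3) : ℝ := if i = 0 then 1 / 2 else 1 / 4

/-- The product weight `q ⊗ q` on the grid `Fin 3 × Fin 3`. [this work] -/
noncomputable def gridW (x : Fin 3 × Fin 3) : ℝ := gridQ x.1 * gridQ x.2

/-- The principal up-set of `(1,1)` in the grid. [this work] -/
def gridA : Finset (Fin 3 × Fin 3) := Finset.univ.filter fun x => ((1 : Fin 3), (1 : Fin 3)) ≤ x

/-- The chain weight is nonnegative. [this work] -/
private theorem gridQ_nonneg (i : Fin 3) : 0 ≤ gridQ i := by
  unfold gridQ; split_ifs <;> norm_num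

/-- On the chain `Fin 3` every weight is log-modular. [folklore] -/
private theorem gridQ_inf_sup (a b : Fin 3) : gridQ a * gridQ b = gridQ (a ⊓ b) * gridQ (a ⊔ b) := by
  rcases le_total a b with h | h
  · rw [inf_eq_left.2 h, sup_eq_right.2 h]
  · rw [inf_eq_right.2 h, sup_eq_left.2 h, mul_comm]

/-- The product of two chain weights is log-modular on the product lattice. [folklore] -/
private theorem gridW_logModular (x y : Fin 3 × Fin 3) : gridW x * gridW y = gridW (x ⊓ y) * gridW (x ⊔ y) := by
  unfold gridW
  rw [Prod.fst_inf, Prod.snd_inf, Prod.fst_sup, Prod.snd_sup]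
  calc gridQ x.1 * gridQ x.2 * (gridQ y.1 * gridQ y.2)
      = (gridQ x.1 * gridQ y.1) * (gridQ x.2 * gridQ y.2) := by ring
    _ = (gridQ (x.1 ⊓ y.1) * gridQ (x.1 ⊔ y.1)) * (gridQ (x.2 ⊓ y.2) * gridQ (x.2 ⊔ y.2)) := by
        rw [gridQ_inf_sup x.1 y.1, gridQ_inf_sup x.2 y.2]
    _ = gridQ (x.1 ⊓ y.1) * gridQ (x.2 ⊓ y.2) * (gridQ (x.1 ⊔ y.1) * gridQ (x.2 ⊔ y.2)) := by ring

/-- The principal up-set of `(1,1)` is an up-set. [this work] -/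
private theorem gridA_upper : IsUpperSet ((gridA : Finset (Fin 3 × Fin 3)) : Set (Fin 3 × Fin 3)) := by
  intro x y hxy hx
  simp only [gridA, Finset.coe_filter, Finset.mem_univ, true_and, Set.mem_setOf_eq] at hx ⊢
  exact le_trans hx hxy

/-- Membership in the principal up-set of `(1,1)`. [this work] -/
private theorem mem_gridA {x : Fin 3 × Fin 3} : x ∈ gridA ↔ ((1 : Fin 3), (1 : Fin 3)) ≤ x := by
  simp [gridA]

/-- The sums over the grid, evaluated. [this work] -/
private theorem grid_sums :
    mass gridW Finset.univ = 1 ∧ mass gridW gridA = 1 / 4 ∧ mass gridW (gridA ∩ gridA) = 1 / 4 ∧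
      gridW ((0 : Fin 3), (0 : Fin 3)) = 1 / 4 ∧ gridW ((0 : Fin 3), (1 : Fin 3)) = 1 / 8 ∧
      gridW ((1 : Fin 3), (0 : Fin 3)) = 1 / 8 ∧ gridW ((1 : Fin 3), (1 : Fin 3)) = 1 / 16 := by
  have hA : mass gridW gridA = 1 / 4 := by
    unfold mass gridA
    rw [Finset.sum_filter, Fintype.sum_prod_type]
    simp [Fin.sum_univ_three, gridW, gridQ, Prod.mk_le_mk]
    norm_num
  refine ⟨?_, hA, by rw [Finset.inter_self]; exact hA, ?_, ?_, ?_, ?_⟩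
  · unfold mass
    rw [Fintype.sum_prod_type]
    simp [Fin.sum_univ_three, gridW, gridQ]
    norm_num
  all_goals simp [gridW, gridQ]
  all_goals norm_num

/-- **`C3MinimalCovFlowConjecture` (log-modular weights on ALL finite distributive lattices) is FALSE**: on `Fin 3 × Fin 3` with the product
weight `(1/2,1/4,1/4)^{⊗2}` and `A = B = ↑(1,1)` no minimal-covariance flow exists (the three sources below `(1,1)` must send `3/32` of covariance
mass into the point `(1,1)`, whose capacity is `21/256`).  The corrected (Boolean) statement is `C3MinimalCovFlowConjectureCube`. [this work] -/
theorem not_C3MinimalCovFlowConjecture : ¬ C3MinimalCovFlowConjecture := by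
  intro h
  obtain ⟨fH, fC, hf⟩ := h (Fin 3 × Fin 3) gridW (fun x => mul_nonneg (gridQ_nonneg _) (gridQ_nonneg _)) gridW_logModular
    gridA gridA gridA_upper gridA_upper
  obtain ⟨hZ, hA, hAA, h00, h01, h10, h11⟩ := grid_sums
  set x₀ : Fin 3 × Fin 3 := ((1 : Fin 3), (1 : Fin 3)) with hx₀
  have hx₀A : x₀ ∈ gridA := mem_gridA.2 le_rfl
  -- the covariance flow out of a source `y ≤ x₀`, `y ∉ A`, is concentrated on `x₀`
  have hconc : ∀ y : Fin 3 × Fin 3, y ≤ x₀ → ∀ x, x ≠ x₀ → fC y x = 0 := by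
    intro y hy x hx
    by_contra hne
    obtain ⟨-, hxA, hmin⟩ := hf.minC y x hne
    have hxA' : x₀ ≤ x := mem_gridA.1 (Finset.mem_inter.1 hxA).1
    have := hmin x₀ hy (Finset.mem_inter.2 ⟨hx₀A, hx₀A⟩) hxA'
    exact hx (le_antisymm this hxA')
  have hrow : ∀ y : Fin 3 × Fin 3, y ≤ x₀ → y ∉ gridA → fC y x₀ = (3 / 16 : ℝ) * gridW y := by
    intro y hy hyA
    have h1 := hf.rowC y
    rw [Finset.sum_eq_single x₀ (fun x _ hx => hconc y hy x hx) (fun h => absurd (Finset.mem_univ _) h)] at h1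
    rw [h1]
    unfold covSupply
    rw [if_neg (fun h => hyA (Finset.mem_inter.1 h).1), hZ, hAA, hA]
    norm_num
  have hy00 : ((0 : Fin 3), (0 : Fin 3)) ≤ x₀ := by decide
  have hy01 : ((0 : Fin 3), (1 : Fin 3)) ≤ x₀ := by decide
  have hy10 : ((1 : Fin 3), (0 : Fin 3)) ≤ x₀ := by decide
  have hn00 : ((0 : Fin 3), (0 : Fin 3)) ∉ gridA := by decide
  have hn01 : ((0 : Fin 3), (1 : Fin 3)) ∉ gridA := by decide
  have hn10 : ((1 : Fin 3), (0 : Fin 3)) ∉ gridA := by decide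
  -- capacity at `x₀`
  have hcap := hf.col x₀
  have hcapv : c3Capacity gridW gridA gridA x₀ = 21 / 256 := by
    unfold c3Capacity
    rw [if_pos (Finset.mem_inter.2 ⟨hx₀A, hx₀A⟩), hZ, hA, hAA, h11]
    norm_num
  -- the three sources alone exceed it
  have hsub : fC ((0 : Fin 3), (0 : Fin 3)) x₀ + fC ((0 : Fin 3), (1 : Fin 3)) x₀ + fC ((1 : Fin 3), (0 : Fin 3)) x₀
      ≤ ∑ y, (fH y x₀ + fC y x₀) := by
    have hle : ∀ y, fC y x₀ ≤ fH y x₀ + fC y x₀ := fun y => le_add_of_nonneg_left (hf.nonnegH y x₀)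
    have hnn : ∀ y ∈ (Finset.univ : Finset (Fin 3 × Fin 3)), 0 ≤ fH y x₀ + fC y x₀ :=
      fun y _ => add_nonneg (hf.nonnegH y x₀) (hf.nonnegC y x₀)
    have h3 : ∑ y ∈ ({((0 : Fin 3), (0 : Fin 3)), ((0 : Fin 3), (1 : Fin 3)), ((1 : Fin 3), (0 : Fin 3))} :
        Finset (Fin 3 × Fin 3)), (fH y x₀ + fC y x₀) ≤ ∑ y, (fH y x₀ + fC y x₀) :=
      Finset.sum_le_sum_of_subset_of_nonneg (Finset.subset_univ _) fun y hy _ => hnn y hy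
    have h3' : ∑ y ∈ ({((0 : Fin 3), (0 : Fin 3)), ((0 : Fin 3), (1 : Fin 3)), ((1 : Fin 3), (0 : Fin 3))} :
        Finset (Fin 3 × Fin 3)), (fH y x₀ + fC y x₀)
        = (fH ((0 : Fin 3), (0 : Fin 3)) x₀ + fC ((0 : Fin 3), (0 : Fin 3)) x₀)
          + ((fH ((0 : Fin 3), (1 : Fin 3)) x₀ + fC ((0 : Fin 3), (1 : Fin 3)) x₀)
          + (fH ((1 : Fin 3), (0 : Fin 3)) x₀ + fC ((1 : Fin 3), (0 : Fin 3)) x₀)) := by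
      rw [Finset.sum_insert (by decide), Finset.sum_insert (by decide), Finset.sum_singleton]
    linarith [hle ((0 : Fin 3), (0 : Fin 3)), hle ((0 : Fin 3), (1 : Fin 3)), hle ((1 : Fin 3), (0 : Fin 3))]
  rw [hrow _ hy00 hn00, hrow _ hy01 hn01, hrow _ hy10 hn10, h00, h01, h10] at hsub
  rw [hcapv] at hcap
  linarith

end Refutation

/-- The product (Bernoulli) weight on the Boolean lattice `Finset ι`: `μ_p(S) = ∏_i (p_i if i ∈ S else 1 − p_i)`. [folklore] -/
noncomputable def cubeWeight {ι : Type*} [Fintype ι] [DecidableEq ι] (p : ι → ℝ) (S : Finset ι) : ℝ :=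
  ∏ i, if i ∈ S then p i else 1 - p i

/-- **CONJECTURE R7, corrected scope (Boolean lattices = product measures on `{0,1}^ι`).**  For every finite `ι`, every `p ∈ [0,1]^ι` and
every pair of up-sets of the Boolean lattice `Finset ι` there is a minimal-covariance `C₃`-flow for the product weight `cubeWeight p`.  This
is exactly what the census supports (`k ≤ 5` exhaustive, see the module docstring); it implies Kahn's Conjecture 5 in lattice form
(`latticeE3_nonneg_of_minimalCovFlowConjectureCube`).  It does NOT extend to products of longer chains (`not_C3MinimalCovFlowConjecture`).
An obligation / hypothesis, never a fact. [this work] [status: open, census-validated k ≤ 5] -/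
@[conjecture] def C3MinimalCovFlowConjectureCube : Prop :=
  ∀ (ι : Type) [Fintype ι] [DecidableEq ι] (p : ι → ℝ), (∀ i, 0 ≤ p i ∧ p i ≤ 1) →
    ∀ A B : Finset (Finset ι), IsUpperSet (A : Set (Finset ι)) → IsUpperSet (B : Set (Finset ι)) →
      ∃ fH fC : Finset ι → Finset ι → ℝ, IsMinimalCovFlow (cubeWeight p) A B fH fC

/-- R7 (Boolean form) implies Kahn's Conjecture 5 in lattice form: `latticeE3 (cubeWeight p) A B C ≥ 0` for all up-sets of `Finset ι`.
[this work] -/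
theorem latticeE3_nonneg_of_minimalCovFlowConjectureCube (h : C3MinimalCovFlowConjectureCube) (ι : Type) [Fintype ι] [DecidableEq ι]
    {p : ι → ℝ} (hp : ∀ i, 0 ≤ p i ∧ p i ≤ 1) {A B C : Finset (Finset ι)} (hA : IsUpperSet (A : Set (Finset ι)))
    (hB : IsUpperSet (B : Set (Finset ι))) (hC : IsUpperSet (C : Set (Finset ι))) : 0 ≤ latticeE3 (cubeWeight p) A B C := by
  obtain ⟨fH, fC, hf⟩ := h ι p hp B C hB hC
  exact latticeE3_nonneg_of_isMinimalCovFlow hf hA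


end Summit.CriticalPhenomena.PercolationContinuityZ3.Theorems.C3Transport
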